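import Mathlib
import Literature.NumberTheory.DiophantineGeometry.GeneralizedFermatSignatureNN3

/-!
# Venture AbcShadow — SH-04 STATEMENT (struck exception): `x¹³ + 47^α y¹³ = z³` has no coprime solution with `|xy| > 1`

HONEST FRAMING. Statement file of the work-bound cell `abc-shadow` (row SH-04 of its census, sub-row "the printed
possibly-exceptional pair `(p, n) = (47, 13)` of [BVY04, Thm 1.6] REMOVED"; typer seat `abc-shadow-typ-1`, lineage g2).
This file PROVES NOTHING about the equation: it types the TARGET as a plain `Prop` (`SH04Pair47_13`) in EXACTLY the binder
shape of the tree's rendering of the printed theorem, `Literature.NumberTheory.DiophantineGeometry.BennettVatsalYazdani2004.thm16`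
("`xⁿ + p^α yⁿ = z³` has no solutions in coprime integers `x, y` and `z` with `|xy| > 1`", pairwise coprime rendering),
specialised to `p = 47`, `n = 13`, every `α ≥ 1` — i.e. the assertion that the pair `(47, 13)`, which print lists in
`thm16Exceptional` ("unless, possibly, `(p, n) ∈ {(13,19), (29,11), (43,13), (47,13), …}`", p. 1400), is NOT an exception.
Two kernel facts record why `(47, 13)` is excepted in print ONLY through that list: `(47, 13) ∈ thm16Exceptional` and
`13 ∤ 47² − 1` (`sh04Pair47_13_listed`). ADJACENT result (generalized Fermat, signature `(n, n, 3)`), NOT abc: nothing here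
is a claim on the abc conjecture or on any summit, and nothing here takes a side on IUT. The conditional derivation (a
typed/kernel-checked REDUCTION to named print inputs + the COMPUTED newform data of levels `141, 423, 1269 = 3^δ·47`,
certificate 4a36c28685fe0350 part C) is `SH04/Row47_13.lean`.
-/

namespace Summit.Ventures.AbcShadow

open Literature.NumberTheory.DiophantineGeometry.BennettVatsalYazdani2004 (thm16Exceptional thm16Primes)

/-- **SH-04, the struck exception `(p, n) = (47, 13)` of [BVY04, Thm 1.6]** (census row of the cell `abc-shadow`): for
every `α ≥ 1` the equation `x¹³ + 47^α · y¹³ = z³` has NO solution in pairwise coprime integers `x, y, z` with `|xy| > 1`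
— the `(p, n) = (47, 13)` instance of the conclusion of `thm16`, which print excludes ("unless, possibly, …
`(p, n) ∈ {…, (47, 13), …}`"). Plain `Prop`; nothing is asserted here. ADJACENT, NOT abc.
[cite: BennettVatsalYazdani2004, Thm 1.6 p.1400 (the possibly-exceptional pair (47,13), here asserted NOT to occur)] -/
def SH04Pair47_13 : Prop :=
  ∀ α : ℕ, 0 < α → ∀ x y z : ℤ, IsCoprime x y → IsCoprime x z → IsCoprime y z → 1 < |x * y| →
    x ^ 13 + (47 : ℤ) ^ α * y ^ 13 ≠ z ^ 3

/-- Bookkeeping [cite: BennettVatsalYazdani2004, Thm 1.6 p.1400]: `47` is one of the primes of Theorem 1.6, the pair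
`(47, 13)` IS on print's possibly-exceptional list, and it is NOT covered by the other printed escape clause
"`n` divides `p² − 1`" (`47² − 1 = 2208 = 13·169 + 11`), so `SH04Pair47_13` is exactly what print leaves open there. -/
theorem sh04Pair47_13_listed : 47 ∈ thm16Primes ∧ (47, 13) ∈ thm16Exceptional ∧ ¬ (13 ∣ 47 ^ 2 - 1) := by
  refine ⟨by decide, by decide, by norm_num⟩

end Summit.Ventures.AbcShadow
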